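import Literature.Computability.MetaComplexity.ScopeExpansion
import Literature.Computability.MetaComplexity.PolynomialCalculusRespectfulExpanderTheorem
import HarnessLib

/-!
# Alekhnovich–Razborov's degree lower bound for expanding CNFs (Mikša–Nordström 2015, Thm 4.2), proved

The warm-up application of Mikša–Nordström's generalised method (CCC 2015 Thm 4.2 = arXiv:1505.01358
Thm 35, "Theorem ([AR03])"): "For any CNF formula `F` and any constant `δ > 0` it holds that if the
clause-variable incidence graph `G(F)` is an `(s, δ)`-boundary expander, then the polynomial
calculus degree required to refute `F` is `> δs/2`" — Alekhnovich–Razborov's lower bound for CNFs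
whose clause–variable incidence graph is a unique-neighbour (boundary) expander (the input behind
the PC degree lower bounds for random `k`-CNF).  Here:

* `PC.clauseScope φ i` — the variable set of the `i`-th clause (the scopes whose boundary
  expansion, `IsBoundaryExpander` of `ScopeExpansion.lean`, is the clause–variable incidence
  expansion of MN15 Def. 4.1);
* the structure of MN15's proof: `𝓕 i = {C_i}`, `𝒱 x = {x}` for the variables `x` of `φ`, `E = ∅`
  (`PC.cnfFam`, `PC.cnfVset`), its respectful neighbours (`isRespNbr_of_mem_clauseScope`: "we can
  set the neighbouring variable so that the clause is satisfied"), respectful expansion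
  (`isRespExpander_cnf`), overlap `1`, and satisfiability of every `≤ s` clauses
  (`locSol_cnf_nonempty`, peeling clauses with a private variable — MN15 arXiv:1505.01358
  Lemma 32 in this case);
* **`PC.not_refutableInDegree_of_isBoundaryExpander`**: for `s ≥ 2`, `δ > 0` and
  `D ≤ δs/2`, no PC refutation of `φ` of degree `≤ D`, over any field.

Source: M. Mikša, J. Nordström, CCC 2015 (LIPIcs 33) Thm 4.2 and its proof = arXiv:1505.01358
Def. 34 / Thm 35 [MiksaNordstrom2015] (held copy `paper:arxiv-1505.01358` p0019); the original is
M. Alekhnovich, A. Razborov, FOCS 2001 / Proc. Steklov Inst. 242 (2003) [AlekhnovichRazborov2001].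
Hypotheses made explicit: `2 ≤ s` (the method's granularity), `0 < δ`.
-/

noncomputable section

namespace Literature.Computability.MetaComplexity

namespace PC

open Finset MvPolynomial Literature.Computability.Complexity PCResidue MiksaNordstrom

variable (φ : CNF ℕ)

/-- The variable set of the `i`-th clause of `φ` (the scopes of the clause–variable incidence
graph). [Mikša–Nordström 2015, Def. 4.1 / Thm 4.2 ("clause-variable incidence graph `G(F)`")]
[cite: MiksaNordstrom2015, Definition 4.1] -/
def clauseScope (i : Fin φ.length) : Finset ℕ := ((φ.get i).map Prod.fst).toFinset

/-- All variables of `φ`. [Mikša–Nordström 2015, §2] [cite: MiksaNordstrom2015, §2] -/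
def cnfVars : Finset ℕ := (φ.flatMap fun C => C.map Prod.fst).toFinset

/-- `𝓕`: the clauses of `φ` as one-clause subformulas. [Mikša–Nordström 2015, proof of Thm 4.2
("the set of clauses of `F` interpreted as one-clause CNF formulas")] [cite: MiksaNordstrom2015, Theorem 4.2] -/
def cnfFam : Fin φ.length → CNF ℕ := fun i => [φ.get i]

/-- `𝒱`: the variables of `φ` as singleton sets. [Mikša–Nordström 2015, proof of Thm 4.2 ("the set
of variables partitioned into singleton sets")] [cite: MiksaNordstrom2015, Theorem 4.2] -/
def cnfVset : {x // x ∈ cnfVars φ} → Finset ℕ := fun x => {x.1}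

variable {φ}

/-- Membership in a clause scope. [Mikša–Nordström 2015, Def. 4.1] [cite: MiksaNordstrom2015, Definition 4.1] -/
theorem mem_clauseScope {i : Fin φ.length} {x : ℕ} :
    x ∈ clauseScope φ i ↔ ∃ l ∈ φ.get i, l.1 = x := by
  simp [clauseScope]

/-- A variable of a clause is a variable of `φ`. [folklore-free bookkeeping of MN15 §2]
[cite: MiksaNordstrom2015, §2] -/
theorem mem_cnfVars_of_mem_clauseScope {i : Fin φ.length} {x : ℕ} (hx : x ∈ clauseScope φ i) :
    x ∈ cnfVars φ := by
  obtain ⟨l, hl, rfl⟩ := mem_clauseScope.1 hx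
  simp only [cnfVars, List.mem_toFinset, List.mem_flatMap, List.mem_map]
  exact ⟨φ.get i, List.get_mem φ i, l, hl, rfl⟩

/-- Neighbours in the structure are incidences: `{x} ~ C_i ⇔ x ∈ Vars(C_i)`. [Mikša–Nordström 2015,
proof of Thm 4.2] [cite: MiksaNordstrom2015, Theorem 4.2] -/
theorem isNbr_cnf_iff {i : Fin φ.length} {x : {x // x ∈ cnfVars φ}} :
    IsNbr (cnfFam φ) (cnfVset φ) i x ↔ x.1 ∈ clauseScope φ i := by
  constructor
  · rintro ⟨C, hC, l, hl, hlx⟩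
    rw [cnfFam, List.mem_singleton] at hC
    subst hC
    rw [cnfVset, Finset.mem_singleton] at hlx
    exact mem_clauseScope.2 ⟨l, hl, hlx⟩
  · intro hx
    obtain ⟨l, hl, hlx⟩ := mem_clauseScope.1 hx
    exact ⟨φ.get i, by simp [cnfFam], l, hl, by rw [cnfVset, Finset.mem_singleton]; exact hlx⟩

/-- **Respectful neighbours**: a variable of `C_i` respectfully satisfies `{C_i}` ("we can set the
neighbouring variable so that the clause is satisfied"; `E = ∅`). [Mikša–Nordström 2015, proof of
Thm 4.2] [cite: MiksaNordstrom2015, Theorem 4.2] -/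
theorem isRespNbr_of_mem_clauseScope {i : Fin φ.length} {x : {x // x ∈ cnfVars φ}}
    (hx : x.1 ∈ clauseScope φ i) : IsRespNbr (cnfFam φ) (cnfVset φ) [] i x := by
  obtain ⟨l, hl, hlx⟩ := mem_clauseScope.1 hx
  refine ⟨isNbr_cnf_iff.2 hx, fun _ => l.2, fun C hC => ?_, fun C hC => by simp at hC⟩
  rw [cnfFam, List.mem_singleton] at hC
  subst hC
  exact ⟨l, hl, by rw [cnfVset, Finset.mem_singleton]; exact hlx, rfl⟩

/-- **Boundary expansion is respectful boundary expansion** of the structure (slack `0`).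
[Mikša–Nordström 2015, proof of Thm 4.2 ("`G(F)` is an `(s, δ, 0, ∅)`-respectful boundary
expander")] [cite: MiksaNordstrom2015, Theorem 4.2] -/
theorem isRespExpander_cnf {s δ : ℝ} (hexp : IsBoundaryExpander (clauseScope φ) s δ) :
    IsRespExpander (cnfFam φ) (cnfVset φ) [] s δ 0 := by
  classical
  intro S hS
  rw [sub_zero]
  refine (hexp S hS).trans ?_
  have hsub : boundary (clauseScope φ) S ⊆
      (respBoundary (cnfFam φ) (cnfVset φ) [] S).map (Function.Embedding.subtype _) := by
    intro x hx
    obtain ⟨hcov, hdeg⟩ := mem_boundary.1 hx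
    obtain ⟨i, hi, hxi⟩ := mem_cover.1 hcov
    rw [coverDegree, Finset.card_eq_one] at hdeg
    obtain ⟨i₀, hi₀⟩ := hdeg
    have huniq : ∀ i' ∈ S, x ∈ clauseScope φ i' → i' = i := fun i' hi' hx' => by
      have h1 : i' ∈ ({i₀} : Finset _) := by rw [← hi₀]; exact Finset.mem_filter.2 ⟨hi', hx'⟩
      have h2 : i ∈ ({i₀} : Finset _) := by rw [← hi₀]; exact Finset.mem_filter.2 ⟨hi, hxi⟩
      rw [Finset.mem_singleton.1 h1, Finset.mem_singleton.1 h2]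
    refine Finset.mem_map.2 ⟨⟨x, mem_cnfVars_of_mem_clauseScope hxi⟩, mem_respBoundary.2
      ⟨i, hi, isRespNbr_of_mem_clauseScope hxi, fun i' hi' hne hn => hne ?_⟩, rfl⟩
    exact huniq i' hi' (isNbr_cnf_iff.1 hn)
  exact_mod_cast (Finset.card_le_card hsub).trans (Finset.card_map _).le

/-- In an `(s, δ)`-boundary expander (`δ > 0`) every nonempty set of `≤ s` clauses has a clause with
a private variable. [Mikša–Nordström 2015, proof of arXiv:1505.01358 Lemma 32 (p. 17)]
[cite: MiksaNordstrom2015, Theorem 3.6] -/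
theorem exists_private_var {s δ : ℝ} (hexp : IsBoundaryExpander (clauseScope φ) s δ) (hδ : 0 < δ)
    {S : Finset (Fin φ.length)} (hS : (S.card : ℝ) ≤ s) (hne : S.Nonempty) :
    ∃ i ∈ S, ∃ x ∈ clauseScope φ i, ∀ i' ∈ S, i' ≠ i → x ∉ clauseScope φ i' := by
  classical
  have hpos : (0 : ℝ) < (boundary (clauseScope φ) S).card := by
    have h1 := hexp S hS
    have h2 : (0 : ℝ) < S.card := by exact_mod_cast Finset.card_pos.2 hne
    nlinarith
  obtain ⟨x, hx⟩ := Finset.card_pos.1 (by exact_mod_cast hpos)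
  obtain ⟨hcov, hdeg⟩ := mem_boundary.1 hx
  obtain ⟨i, hi, hxi⟩ := mem_cover.1 hcov
  rw [coverDegree, Finset.card_eq_one] at hdeg
  obtain ⟨i₀, hi₀⟩ := hdeg
  refine ⟨i, hi, x, hxi, fun i' hi' hne hx' => hne ?_⟩
  have h1 : i' ∈ ({i₀} : Finset _) := by rw [← hi₀]; exact Finset.mem_filter.2 ⟨hi', hx'⟩
  have h2 : i ∈ ({i₀} : Finset _) := by rw [← hi₀]; exact Finset.mem_filter.2 ⟨hi, hxi⟩
  rw [Finset.mem_singleton.1 h1, Finset.mem_singleton.1 h2]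

/-- **Satisfiability of small clause sets**: in an `(s, δ)`-boundary expander every set of `≤ s`
clauses is simultaneously satisfiable (peel a clause with a private variable, satisfy the rest,
then set the private variable). [Mikša–Nordström 2015, arXiv:1505.01358 (Lemma 32,
Cor. 33) for the clause–variable structure] [cite: MiksaNordstrom2015, Theorem 4.2] -/
theorem locSol_cnf_nonempty {s δ : ℝ} (hexp : IsBoundaryExpander (clauseScope φ) s δ) (hδ : 0 < δ)
    (S : Finset (Fin φ.length)) (hS : (S.card : ℝ) ≤ s) :
    (locSol (cnfFam φ) [] S).Nonempty := by
  classical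
  induction hc : S.card using Nat.strong_induction_on generalizing S with
  | _ c ih =>
    by_cases hempty : S = ∅
    · exact ⟨fun _ => false, by simp, by simp [hempty]⟩
    obtain ⟨i, hi, x, hxi, hpriv⟩ :=
      exists_private_var hexp hδ hS (Finset.nonempty_iff_ne_empty.2 hempty)
    have hlt : (S.erase i).card < c := by rw [← hc]; exact Finset.card_erase_lt_of_mem hi
    obtain ⟨y, -, hy⟩ := ih _ hlt (S.erase i) (le_trans (by exact_mod_cast Finset.card_erase_le) hS) rfl
    obtain ⟨l, hl, hlx⟩ := mem_clauseScope.1 hxi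
    -- set the private variable `x` so that the literal `l` of `C_i` becomes true
    refine ⟨ovr (toRestr {x} fun _ => l.2) y, by simp, fun i' hi' C hC => ?_⟩
    rw [cnfFam, List.mem_singleton] at hC
    subst hC
    by_cases h : i' = i
    · subst h
      exact eval_ovr_of_pSat ⟨l, hl, by rw [Finset.mem_singleton]; exact hlx, rfl⟩ y
    · have hnt : ¬ Touches {x} (φ.get i') := by
        rintro ⟨l', hl', hl'x⟩
        rw [Finset.mem_singleton] at hl'x
        exact hpriv i' hi' h (mem_clauseScope.2 ⟨l', hl', hl'x⟩)
      rw [eval_ovr_of_not_touches _ hnt]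
      exact hy i' (Finset.mem_erase.2 ⟨h, hi'⟩) _ (List.mem_singleton.2 rfl)

/-- **Alekhnovich–Razborov's theorem for expanding CNFs (Mikša–Nordström 2015, Thm 4.2), proved**:
if the clause–variable incidence graph of `φ` is an `(s, δ)`-boundary expander (`s ≥ 2`, `δ > 0`),
then `φ` has no PC refutation of degree `≤ D` for any `D ≤ δs/2`, over any field ("the polynomial
calculus degree required to refute `F` is `> δs/2`"). [Mikša–Nordström 2015, Thm 4.2 ([AR03]);
Alekhnovich–Razborov 2001/2003] [cite: MiksaNordstrom2015, Theorem 4.2] -/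
theorem not_refutableInDegree_of_isBoundaryExpander {K : Type*} [Field K] (φ : CNF ℕ) {s δ : ℝ}
    (hs : 2 ≤ s) (hδ : 0 < δ) (hexp : IsBoundaryExpander (clauseScope φ) s δ) {D : ℕ}
    (hD : (D : ℝ) ≤ δ * s / 2) : ¬ PC.RefutableInDegree (PC.ofCNF K φ) D := by
  classical
  refine MiksaNordstrom.not_refutableInDegree (𝓕 := cnfFam φ) (𝒱 := cnfVset φ) (E := [])
    (ℓ := 1) (isRespExpander_cnf hexp) hδ hs (fun x => ⟨fun _ => false, fun C hC => by simp at hC⟩)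
    le_rfl (fun x => ?_) (locSol_cnf_nonempty hexp hδ) (fun C hC => ?_) ?_
  · -- overlap `1`: the sets `{x}` containing a given variable form at most a singleton
    refine Finset.card_le_one.2 fun a ha b hb => ?_
    simp only [Finset.mem_filter, Finset.mem_univ, true_and, cnfVset, Finset.mem_singleton] at ha hb
    exact Subtype.ext (ha ▸ hb ▸ rfl)
  · obtain ⟨i, rfl⟩ := List.mem_iff_get.1 hC
    exact Or.inr ⟨i, by simp [cnfFam]⟩
  · rwa [mul_zero, sub_zero, Nat.cast_one, mul_one]

end PC

end Literature.Computability.MetaComplexity
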